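import Summits.ResolutionOfSingularities.ResolutionOfSingularities.Theses.Valuative
import Summits.ResolutionOfSingularities.ResolutionOfSingularities.Theorems.ValuativeTorsorToLurelFfiniteTower
import Summits.ResolutionOfSingularities.ResolutionOfSingularities.Theorems.ValuativeTorsorToLurelFfiniteFrobenius
import Summits.ResolutionOfSingularities.ResolutionOfSingularities.Theorems.ValuativeTorsorToLurelFfiniteGenerators
import Summits.ResolutionOfSingularities.ResolutionOfSingularities.Theorems.ValuativeTorsorToLurelFfiniteAbsorb
import Literature.AlgebraicGeometry.Resolution.InseparableLocalUniformization
import Literature.AlgebraicGeometry.Resolution.InseparableLocalUniformizationRelativeOneLeaf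

/-!
# `Valuative.TorsorToLurelFfinite` from Temkin's inseparable local uniformization

Route `ResolutionOfSingularities/Valuative`, support item `TorsorToLurelFfinite`
(stmt-ResolutionOfSingularities-0643): local uniformization of `α_p`-torsors over bases regular at
the centre (the crux `LuAlphaPTorsor` at the prime `p`, for all ground fields of characteristic
`p`) implies RELATIVE local uniformization `LUrel_p` over every ground field `k` of characteristic
`p` with `[k : k^p] < ∞`.

`torsorToLurelFfinite_of_temkin2013Relative` proves this CONDITIONALLY on the named Literature fact
`Literature.AlgebraicGeometry.Resolution.Temkin2013Relative` (Temkin 2013 = arXiv:0804.1554v3,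
Thm. 1.3.2 in its relative form, corrected rendering; in the tree it is reduced to the single leaf
`Temkin2013RelativeCurveSmoothFibre`). The proof is Temkin's Remark 1.3.5 (i)–(ii) (p. 4):

1. enlarge the prescribed algebra `R ⊆ O` to an affine model `R'` of `K°` (`exists_affineModel`);
2. Thm. 1.3.2: finite purely inseparable `L/K`, `l/k`, an affine model `A' ⊇ R'` and the
   `L`-normalisation `N = Nr_L(A')`, finitely generated over `k`, `Frac N = L`, REGULAR at the
   centre of the extension `O'` of `O` to `L`;
3. Frobenius (Rem. 1.3.5 (i)): with `pⁿ ≥` the exponent of `L/K`, `ρ x = x^{pⁿ} : L → K` maps `N`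
   isomorphically onto `A₀ = ρ(N) ⊆ O`, a finitely generated `k^{pⁿ}`-algebra regular at the centre
   of `O = ρ(O')`, with `K^{pⁿ} ⊆ Frac A₀` (`ValuativeTorsorToLurelFfiniteFrobenius`);
4. tower (Rem. 1.3.5 (ii)): `[k : k^p] < ∞` and `K/k` finitely generated give finitely many
   `g ∈ O` generating `K` over `k^{pⁿ}` (`ValuativeTorsorToLurelFfiniteGenerators`), each with
   `g^{pⁿ} ∈ Frac A₀`; adjoining them one `p`-th root at a time, each step ONE application of the
   crux over the ground field `k^{pⁿ}` (`torsor_roots`, `ValuativeTorsorToLurelFfiniteTower`),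
   yields a finitely generated `k^{pⁿ}`-algebra `A₁ ⊇ A₀` in `O`, regular at the centre, with
   `Frac A₁ = K`;
5. absorption: `A := k[A₁, R']`; every element of `A` has its `pⁿ`-th power in `A₁` (Frobenius is
   additive; `k^{pⁿ} ⊆ A₀`, `R'^{pⁿ} ⊆ ρ(N) = A₀`), so `A ⊆ (A₁)_centre` by normality of the regular
   local ring and `A` is regular at the centre (`isRegularLocalRing_centre_of_pow_mem`,
   `ValuativeTorsorToLurelFfiniteAbsorb`); `R ⊆ R' ⊆ A ⊆ O`, `A` finitely generated over `k`,
   `Frac A = K`.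

Only REGULARITY of the centre of `N` is used (not its `l`-smoothness), which is why the
`F`-finiteness hypothesis is needed in step 4; the statement for all `k` is the sibling item
`TorsorToLurel`.
-/

noncomputable section

set_option linter.dupNamespace false -- mandated namespace of this single-conjunct summit

open IsLocalRing
open Literature.AlgebraicGeometry.Resolution

namespace Summit.ResolutionOfSingularities.ResolutionOfSingularities.Theorems

/-- **Temkin's reduction, `F`-finite form, conditional on Thm. 1.3.2** (Temkin 2013,
Rem. 1.3.5 (i)–(ii)): the corrected relative form `Temkin2013Relative` of Temkin's inseparable
local uniformization theorem implies the route item `TorsorToLurelFfinite` — local uniformization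
of `α_p`-torsors over regular bases (all ground fields of characteristic `p`) gives relative local
uniformization over every ground field `k` of characteristic `p` with `[k : k^p] < ∞`. -/
theorem torsorToLurelFfinite_of_temkin2013Relative (hTem : Temkin2013Relative.{0}) :
    Summit.ResolutionOfSingularities.ResolutionOfSingularities.Theses.Valuative.TorsorToLurelFfinite := by
  intro p hp hT k K _ _ _ _ hF hfg O hO R hRfg hRO
  classical
  -- Step 0: enlarge `R` to an affine model `R'` of `K°`
  obtain ⟨Am, hAmO, ⟨SA, rfl⟩, hAmfr⟩ := exists_affineModel k K hfg O hO
  obtain ⟨SR, rfl⟩ := hRfg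
  let Oalg : Subalgebra k K := { O.toSubring with algebraMap_mem' := hO }
  let R' : Subalgebra k K := Algebra.adjoin k ((SR ∪ SA : Finset K) : Set K)
  have hRR' : Algebra.adjoin k (SR : Set K) ≤ R' :=
    Algebra.adjoin_mono (by rw [Finset.coe_union]; exact Set.subset_union_left)
  have hAmR' : Algebra.adjoin k (SA : Set K) ≤ R' :=
    Algebra.adjoin_mono (by rw [Finset.coe_union]; exact Set.subset_union_right)
  have hR'O : R'.toSubring ≤ O.toSubring := by
    have hle : R' ≤ Oalg := Algebra.adjoin_le (by
      rw [Finset.coe_union]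
      rintro x (hx | hx)
      · exact hRO (Algebra.subset_adjoin hx)
      · exact hAmO (Algebra.subset_adjoin hx))
    exact fun x hx => hle hx
  have hR'fg : R'.FG := ⟨_, rfl⟩
  haveI hR'fr : IsFractionRing R' K := by
    refine IsFractionRing.of_field R' K fun z => ?_
    obtain ⟨a, b, -, rfl⟩ := IsFractionRing.div_surjective (A := Algebra.adjoin k (SA : Set K)) z
    exact ⟨⟨a, hAmR' a.2⟩, ⟨b, hAmR' b.2⟩, rfl⟩
  -- Step 1: Temkin's theorem
  obtain ⟨L, iF, iA, iA', iT, hfin, hpi, l, -, -, A', hR'A', -, -, -, O', hO', N, hN, hNint, hNfg,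
    hNfr, -, -, hNreg⟩ := hTem k K hfg O hO R' hR'O hR'fg hR'fr
  -- Step 2: Frobenius transport of the chart `N`
  haveI : CharP K p := (Algebra.charP_iff k K p).mp inferInstance
  set n : ℕ := IsPurelyInseparable.exponent K L with hn
  set ρ : L →+* K := IsPurelyInseparable.iterateFrobenius K L p (le_refl n) with hρ
  set F : Subfield K := ((algebraMap k K).comp (iterateFrobenius k p n)).fieldRange with hFdef
  haveI : CharP F p := (Algebra.charP_iff F K p).mpr inferInstance
  have hO'eq : O.comap ρ = O' := comap_iterateFrobenius_eq p (le_refl n) O O' hO'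
  subst hO'eq
  obtain ⟨A₀, hA₀, hA₀fg⟩ :=
    exists_subalgebra_frobeniusBaseField (le_refl n) (N.restrictScalars k) hNfg
  have hA₀' : N.toSubring.map ρ = A₀.toSubring := hA₀.symm
  have h₀ : A₀.toSubring ≤ O.toSubring := by
    rw [← hA₀']
    exact map_iterateFrobenius_le p (le_refl n) O N.toSubring hN
  have hreg₀ : IsRegularLocalRing (Localization.AtPrime
      (Ideal.comap (Subring.inclusion h₀) (maximalIdeal O))) :=
    (isRegularLocalRing_centre_map_iterateFrobenius p (le_refl n) O N.toSubring hN A₀.toSubring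
      hA₀' h₀).mp hNreg
  have hNfr' : ∀ y : L, ∃ a ∈ N.toSubring, ∃ b ∈ N.toSubring, y = a / b := fun y => by
    obtain ⟨a, b, -, rfl⟩ := IsFractionRing.div_surjective (A := N) y
    exact ⟨a, a.2, b, b.2, rfl⟩
  have hKp : ∀ x : K, x ^ p ^ n ∈ IntermediateField.adjoin F (A₀ : Set K) :=
    pow_mem_adjoin_of_isFractionRing (le_refl n) N.toSubring hNfr' A₀ hA₀
  -- Step 3: finitely many generators of `K` over `k^{pⁿ}` inside `O`
  obtain ⟨G, hGO, hGtop⟩ := exists_finset_generators_over_frobeniusBaseField k K p hF hfg O hO n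
  -- Step 4: climb the `p`-radical tower with the crux
  obtain ⟨A₁, h₁, hle₁, hfg₁, hreg₁, hadj₁⟩ :=
    torsor_roots hT O n G A₀ h₀ hA₀fg hreg₀ hGO (fun g _ => hKp g)
  have htop : IntermediateField.adjoin F (A₁ : Set K) = ⊤ :=
    hGtop _ (by
      rw [hadj₁]
      exact fun g hg => IntermediateField.subset_adjoin F _ (Or.inr hg))
  haveI hA₁fr : IsFractionRing A₁.toSubring K := by
    refine IsFractionRing.of_field A₁.toSubring K fun z => ?_
    have hz : z ∈ IntermediateField.adjoin F (A₁ : Set K) := by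
      rw [htop]; exact IntermediateField.mem_top
    obtain ⟨r, hr, s, hs, rfl⟩ := IntermediateField.mem_adjoin_iff_div.mp hz
    rw [Algebra.adjoin_eq] at hr hs
    exact ⟨⟨r, hr⟩, ⟨s, hs⟩, rfl⟩
  -- Step 5: absorb `k` and `R'` by normality of the regular centre
  obtain ⟨S₁, hS₁⟩ := hfg₁
  let A : Subalgebra k K := Algebra.adjoin k ((S₁ ∪ (SR ∪ SA) : Finset K) : Set K)
  have hS₁A₁ : (S₁ : Set K) ⊆ A₁ := by rw [← hS₁]; exact Algebra.subset_adjoin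
  have hA₁A : A₁.toSubring ≤ A.toSubring := by
    rw [← hS₁, Algebra.adjoin_eq_ring_closure, Subring.closure_le]
    rintro x (⟨c, rfl⟩ | hx)
    · obtain ⟨a, ha⟩ := frobeniusBaseField_le_range c.2
      change (c : K) ∈ A
      rw [← ha]
      exact A.algebraMap_mem a
    · refine Algebra.subset_adjoin ?_
      rw [Finset.coe_union]
      exact Or.inl hx
  have hAO : A.toSubring ≤ O.toSubring := by
    have hle : A ≤ Oalg := Algebra.adjoin_le (by
      rw [Finset.coe_union, Finset.coe_union]
      rintro x (hx | hx | hx)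
      · exact h₁ (hS₁A₁ hx)
      · exact hRO (Algebra.subset_adjoin hx)
      · exact hAmO (Algebra.subset_adjoin hx))
    exact fun x hx => hle hx
  -- every element of `A` has its `pⁿ`-th power in `A₁`
  have hR'pow : ∀ x ∈ R', x ^ p ^ n ∈ A₁ := by
    intro x hx
    have hxN : algebraMap K L x ∈ N.toSubring := by
      change algebraMap K L x ∈ N
      rw [← SetLike.mem_coe, hNint]
      have hmem : algebraMap K L x ∈ A'.map (IsScalarTower.toAlgHom k K L) :=
        Subalgebra.mem_map.mpr ⟨x, hR'A' hx, rfl⟩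
      exact (isIntegral_algebraMap (R := ↥(A'.map (IsScalarTower.toAlgHom k K L)))
        (A := L) (x := ⟨_, hmem⟩))
    have h := pow_mem_of_algebraMap_mem p (le_refl n) N.toSubring x hxN
    rw [hA₀'] at h
    exact hle₁ h
  have hpow : ∀ x ∈ A.toSubring, x ^ p ^ n ∈ A₁.toSubring := by
    let C : Subalgebra k K :=
      { A₁.toSubring.comap (iterateFrobenius K p n) with
        algebraMap_mem' := fun c => by
          change iterateFrobenius K p n (algebraMap k K c) ∈ A₁.toSubring
          rw [iterateFrobenius_def]
          exact hle₁ (A₀.algebraMap_mem ⟨_, algebraMap_pow_mem_frobeniusBaseField c⟩) }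
    have hAC : A ≤ C := Algebra.adjoin_le (by
      rw [Finset.coe_union, Finset.coe_union]
      rintro x (hx | hx | hx)
      · change iterateFrobenius K p n x ∈ A₁.toSubring
        rw [iterateFrobenius_def]
        exact pow_mem (hS₁A₁ hx) _
      · change iterateFrobenius K p n x ∈ A₁.toSubring
        rw [iterateFrobenius_def]
        exact hR'pow x (hRR' (Algebra.subset_adjoin hx))
      · change iterateFrobenius K p n x ∈ A₁.toSubring
        rw [iterateFrobenius_def]
        exact hR'pow x (hAmR' (Algebra.subset_adjoin hx)))
    intro x hx
    have := hAC hx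
    change iterateFrobenius K p n x ∈ A₁.toSubring at this
    rwa [iterateFrobenius_def] at this
  have hregA := isRegularLocalRing_centre_of_pow_mem O A₁.toSubring A.toSubring hA₁A h₁ hAO
    (pow_pos hp.out.pos n) hpow hreg₁
  refine ⟨A, hAO, ?_, ⟨_, rfl⟩, ?_, hregA⟩
  · exact Algebra.adjoin_mono (by
      rw [Finset.coe_union, Finset.coe_union]
      exact fun x hx => Or.inr (Or.inl hx))
  · refine IsFractionRing.of_field A K fun z => ?_
    obtain ⟨a, b, -, rfl⟩ := IsFractionRing.div_surjective (A := A₁.toSubring) z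
    exact ⟨⟨a, hA₁A a.2⟩, ⟨b, hA₁A b.2⟩, rfl⟩

/-- The same, conditional on the SINGLE remaining leaf of the tree's proof cone of Temkin's
theorem: `Temkin2013RelativeCurveSmoothFibre` (Temkin 2013, Thm. 3.3.1 for `k`-smooth generic
fibres — Berkovich stable modification, Krasner, algebraization), via the in-tree one-line
reduction `Temkin2013Relative.of_smoothFibre`. -/
theorem torsorToLurelFfinite_of_smoothFibre (hsf : Temkin2013RelativeCurveSmoothFibre.{0}) :
    Summit.ResolutionOfSingularities.ResolutionOfSingularities.Theses.Valuative.TorsorToLurelFfinite :=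
  torsorToLurelFfinite_of_temkin2013Relative (Temkin2013Relative.of_smoothFibre hsf)

/-- `TorsorToLurelFfinite` is the `F`-finite special case of the sibling item `TorsorToLurel`
(Temkin's reduction for every ground field of characteristic `p`): the extra hypothesis
`[k : k^p] < ∞` is simply dropped. -/
theorem torsorToLurelFfinite_of_torsorToLurel
    (h : Summit.ResolutionOfSingularities.ResolutionOfSingularities.Theses.Valuative.TorsorToLurel) :
    Summit.ResolutionOfSingularities.ResolutionOfSingularities.Theses.Valuative.TorsorToLurelFfinite := by
  intro p hp hT k K _ _ _ _ _ hfg O hO R hRfg hRO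
  exact h p hp.out hT k K hfg O hO R hRfg hRO

end Summit.ResolutionOfSingularities.ResolutionOfSingularities.Theorems

end
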